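import Summits.CriticalPhenomena.PercolationContinuityZ3.Theorems.PercNearOneGluingNoHeavyLowerTailSahiCombCellTwoTwoCertA
import Summits.CriticalPhenomena.PercolationContinuityZ3.Theorems.PercNearOneGluingNoHeavyLowerTailSahiCombCellTwoTwoCertB
import Summits.CriticalPhenomena.PercolationContinuityZ3.Theorems.PercNearOneGluingNoHeavyLowerTailSahiCombCellTwoTwoCertC
import Summits.CriticalPhenomena.PercolationContinuityZ3.Theorems.PercNearOneGluingNoHeavyLowerTailSahiCombCellTwoTwoCertD
import Summits.CriticalPhenomena.PercolationContinuityZ3.Theorems.PercNearOneGluingNoHeavyLowerTailSahiCombCellTwoTwoCertE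
import Summits.CriticalPhenomena.PercolationContinuityZ3.Theorems.PercNearOneGluingNoHeavyLowerTailSahiCombCellTwoTwoCertF
import Summits.CriticalPhenomena.PercolationContinuityZ3.Theorems.PercNearOneGluingNoHeavyLowerTailSahiCombCellTwoTwoCertG
import Summits.CriticalPhenomena.PercolationContinuityZ3.Theorems.PercNearOneGluingNoHeavyLowerTailSahiCombCellTwoTwoCertH

/-!
# **`TRI_W ≥ 0` ON EVERY CELL `(c,2,2)` OF THE TRIANGLE CLASS** — `FiveUpSet.TriWIneq` for an index cube of ANY dimension when the
# other cube is `W = 2^2 × 2^2` and the two families are cylinders over the two factors (kernel-checked certificates)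

Support file of the one-cut programme (crux `NoHeavyLowerTail`, stmt-CriticalPhenomena-4575; lemma factory `prim-lf-1`, gen 28;
memos `FROM-prim-lf-1-gen27-CELL22-AND-G0GP.md` §5 (the computer-assisted theorem) and `FROM-prim-lf-1-gen28-…` (this kernel version)).

`FiveUpSet.TriWIneq` (`…SahiCombTriWGeneral`, OPEN for index cubes of dimension `≥ 2`) asks `0 ≤ triW P F G` for an up-set `P` of a cube
`W` and monotone families `F, G` of up-sets of `W` indexed by a cube.  For the triangle class of (M⁺⁺-3) (report P5 §10.3/§11.10) the
relevant instances are CYLINDERS: `W = 2^b × 2^c`, `F x = f(x,·) × 2^c`, `G x = 2^b × g(x,·)`, `P = h`, giving the cell `(a,b,c)`,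
`a` = dimension of the index cube.  Known so far: `a ≤ 1` (thin edge, `triW_nonneg_of_card_eq_one`) and several strata for `a = 2`.

**THEOREM `FiveUpSet.triW_nonneg_cell22`.**  For EVERY finite index cube `Finset ζ`, every up-set `P ⊆ Finset (Fin 4)` and all monotone
families `F, G : Finset ζ → Finset (Finset (Fin 4))` with each `F z` one of the six `X`-cylinder up-sets `Cell22.cylX u`
(`∅`, `{w | 0,1 ∈ w}`, `{w | 0 ∈ w}`, `{w | 1 ∈ w}`, `{w | 0 ∈ w ∨ 1 ∈ w}`, `univ` — `Cell22.mem_cylX_iff`; these are exactly the up-sets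
of `W = 2^{0,1} × 2^{2,3}` that are cylinders over the first factor) and each `G z` one of the six `Y`-cylinder up-sets `Cell22.cylY v`
(coordinates `2,3`): `0 ≤ triW P F G`.  I.e. `TriWIneq` holds on every cell `(c,2,2)`, `c` arbitrary — the first cells of the triangle
class with an index cube of dimension `≥ 2` settled for ALL values of the two families (gen 27 had this as a computer-assisted theorem with
floating-point-found, exactly re-verified certificates; here every certificate is re-derived with index-cube atoms only and decided by the
kernel).

PROOF.  `…CellTwoTwoKit`: `2·triW = Σ_z tsym(P; code z, code zᶜ)`; `…CellTwoTwoAtoms`: atoms = five-up-set theorem (`fiveUpSetIneq_holds`)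
and Kleitman's lemma on the index cube for pulled-back up-sets of `M = Up(X) × Up(Y)`, checker `check`, `triW_nonneg_of_check`;
`…CellTwoTwoCertA–H`: for each of the 168 up-sets `P` (pairs of byte masks) an integer certificate, `decide +kernel`;
here: dispatch over the twenty low bytes (`exists_check`) and assembly.
HONEST LABEL: one new family of cells of `TriWIneq`/(M⁺⁺-3) (block sizes `(c,2,2)`, all `c`), by 168 kernel-checked finite certificates;
`TriWIneq` in general (and the cells `(c,b,b')` with `b + b' ≥ 5`) remains OPEN.  The identification of `triW` on cylinders with the
(M⁺⁺-3) coefficient is `SahiHybrid.hybCoeff_eq_tri` (thin edge in the tree; the general-`a` cylinder transport is bookkeeping not yet in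
the tree). [this work]
-/

namespace Summit.CriticalPhenomena.PercolationContinuityZ3.Theorems

namespace FiveUpSet

namespace Cell22

open Finset

/-- The six `X`-cylinder up-sets, explicitly. [this work] -/
theorem mem_cylX_iff (u : Fin 6) (w : Finset (Fin 4)) :
    w ∈ cylX u ↔ ((u = 1 ∧ (0 : Fin 4) ∈ w ∧ (1 : Fin 4) ∈ w) ∨ (u = 2 ∧ (0 : Fin 4) ∈ w) ∨ (u = 3 ∧ (1 : Fin 4) ∈ w)
      ∨ (u = 4 ∧ ((0 : Fin 4) ∈ w ∨ (1 : Fin 4) ∈ w)) ∨ u = 5) := by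
  rw [mem_cylX]; revert u w; decide

/-- The six `Y`-cylinder up-sets, explicitly. [this work] -/
theorem mem_cylY_iff (v : Fin 6) (w : Finset (Fin 4)) :
    w ∈ cylY v ↔ ((v = 1 ∧ (2 : Fin 4) ∈ w ∧ (3 : Fin 4) ∈ w) ∨ (v = 2 ∧ (2 : Fin 4) ∈ w) ∨ (v = 3 ∧ (3 : Fin 4) ∈ w)
      ∨ (v = 4 ∧ ((2 : Fin 4) ∈ w ∨ (3 : Fin 4) ∈ w)) ∨ v = 5) := by
  rw [mem_cylY]; revert v w; decide

/-- Trace of a point on the `X`-coordinates `0,1`, with the two membership bits. [this work] -/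
theorem inter01_cases : ∀ w : Finset (Fin 4),
    (w ∩ {0, 1} = ∅ ∧ (0 : Fin 4) ∉ w ∧ (1 : Fin 4) ∉ w) ∨ (w ∩ {0, 1} = {0} ∧ (0 : Fin 4) ∈ w ∧ (1 : Fin 4) ∉ w)
      ∨ (w ∩ {0, 1} = {1} ∧ (0 : Fin 4) ∉ w ∧ (1 : Fin 4) ∈ w) ∨ (w ∩ {0, 1} = {0, 1} ∧ (0 : Fin 4) ∈ w ∧ (1 : Fin 4) ∈ w) := by
  decide

/-- Trace of a point on the `Y`-coordinates `2,3`, with the two membership bits. [this work] -/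
theorem inter23_cases : ∀ w : Finset (Fin 4),
    (w ∩ {2, 3} = ∅ ∧ (2 : Fin 4) ∉ w ∧ (3 : Fin 4) ∉ w) ∨ (w ∩ {2, 3} = {2} ∧ (2 : Fin 4) ∈ w ∧ (3 : Fin 4) ∉ w)
      ∨ (w ∩ {2, 3} = {3} ∧ (2 : Fin 4) ∉ w ∧ (3 : Fin 4) ∈ w) ∨ (w ∩ {2, 3} = {2, 3} ∧ (2 : Fin 4) ∈ w ∧ (3 : Fin 4) ∈ w) := by
  decide

/-- **The `X`-cylinder up-sets of `W` are exactly the six `cylX u`**: an up-set of `Finset (Fin 4)` whose membership depends only on the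
coordinates `0, 1` is `cylX u` for some `u : Fin 6`. [this work] -/
theorem exists_cylX_of_cylinder (S : Finset (Finset (Fin 4))) (hS : IsUpperSet (S : Set (Finset (Fin 4))))
    (hcyl : ∀ w, w ∈ S ↔ w ∩ {0, 1} ∈ S) : ∃ u : Fin 6, S = cylX u := by
  have up : ∀ a b : Finset (Fin 4), a ⊆ b → a ∈ S → b ∈ S := fun a b hab ha => hS hab ha
  have s0 : ({0} : Finset (Fin 4)) ⊆ {0, 1} := by decide
  have s1 : ({1} : Finset (Fin 4)) ⊆ {0, 1} := by decide
  have concl : ∀ u : Fin 6, (∀ w, w ∈ S ↔ ((u = 1 ∧ (0 : Fin 4) ∈ w ∧ (1 : Fin 4) ∈ w) ∨ (u = 2 ∧ (0 : Fin 4) ∈ w)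
      ∨ (u = 3 ∧ (1 : Fin 4) ∈ w) ∨ (u = 4 ∧ ((0 : Fin 4) ∈ w ∨ (1 : Fin 4) ∈ w)) ∨ u = 5)) → ∃ u : Fin 6, S = cylX u := by
    intro u hu; refine ⟨u, ?_⟩; ext w; rw [mem_cylX_iff]; exact hu w
  by_cases he : (∅ : Finset (Fin 4)) ∈ S
  · apply concl 5; intro w
    constructor
    · intro; right; right; right; right; trivial
    · intro; exact up ∅ w (empty_subset w) he
  by_cases hp : ({0} : Finset (Fin 4)) ∈ S
  · have h01 : ({0, 1} : Finset (Fin 4)) ∈ S := up _ _ s0 hp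
    by_cases hq : ({1} : Finset (Fin 4)) ∈ S
    · apply concl 4; intro w; rw [hcyl w]
      rcases inter01_cases w with ⟨h, ha, hb⟩ | ⟨h, ha, hb⟩ | ⟨h, ha, hb⟩ | ⟨h, ha, hb⟩ <;> rw [h] <;> simp [ha, hb, he, hp, hq, h01]
    · apply concl 2; intro w; rw [hcyl w]
      rcases inter01_cases w with ⟨h, ha, hb⟩ | ⟨h, ha, hb⟩ | ⟨h, ha, hb⟩ | ⟨h, ha, hb⟩ <;> rw [h] <;> simp [ha, hb, he, hp, hq, h01]
  by_cases hq : ({1} : Finset (Fin 4)) ∈ S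
  · have h01 : ({0, 1} : Finset (Fin 4)) ∈ S := up _ _ s1 hq
    apply concl 3; intro w; rw [hcyl w]
    rcases inter01_cases w with ⟨h, ha, hb⟩ | ⟨h, ha, hb⟩ | ⟨h, ha, hb⟩ | ⟨h, ha, hb⟩ <;> rw [h] <;> simp [ha, hb, he, hp, hq, h01]
  by_cases h01 : ({0, 1} : Finset (Fin 4)) ∈ S
  · apply concl 1; intro w; rw [hcyl w]
    rcases inter01_cases w with ⟨h, ha, hb⟩ | ⟨h, ha, hb⟩ | ⟨h, ha, hb⟩ | ⟨h, ha, hb⟩ <;> rw [h] <;> simp [ha, hb, he, hp, hq, h01]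
  · apply concl 0; intro w; rw [hcyl w]
    rcases inter01_cases w with ⟨h, ha, hb⟩ | ⟨h, ha, hb⟩ | ⟨h, ha, hb⟩ | ⟨h, ha, hb⟩ <;> rw [h] <;> simp [ha, hb, he, hp, hq, h01]

/-- **The `Y`-cylinder up-sets of `W` are exactly the six `cylY v`.** [this work] -/
theorem exists_cylY_of_cylinder (S : Finset (Finset (Fin 4))) (hS : IsUpperSet (S : Set (Finset (Fin 4))))
    (hcyl : ∀ w, w ∈ S ↔ w ∩ {2, 3} ∈ S) : ∃ v : Fin 6, S = cylY v := by
  have up : ∀ a b : Finset (Fin 4), a ⊆ b → a ∈ S → b ∈ S := fun a b hab ha => hS hab ha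
  have s0 : ({2} : Finset (Fin 4)) ⊆ {2, 3} := by decide
  have s1 : ({3} : Finset (Fin 4)) ⊆ {2, 3} := by decide
  have concl : ∀ v : Fin 6, (∀ w, w ∈ S ↔ ((v = 1 ∧ (2 : Fin 4) ∈ w ∧ (3 : Fin 4) ∈ w) ∨ (v = 2 ∧ (2 : Fin 4) ∈ w)
      ∨ (v = 3 ∧ (3 : Fin 4) ∈ w) ∨ (v = 4 ∧ ((2 : Fin 4) ∈ w ∨ (3 : Fin 4) ∈ w)) ∨ v = 5)) → ∃ v : Fin 6, S = cylY v := by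
    intro v hv; refine ⟨v, ?_⟩; ext w; rw [mem_cylY_iff]; exact hv w
  by_cases he : (∅ : Finset (Fin 4)) ∈ S
  · apply concl 5; intro w
    constructor
    · intro; right; right; right; right; trivial
    · intro; exact up ∅ w (empty_subset w) he
  by_cases hp : ({2} : Finset (Fin 4)) ∈ S
  · have h01 : ({2, 3} : Finset (Fin 4)) ∈ S := up _ _ s0 hp
    by_cases hq : ({3} : Finset (Fin 4)) ∈ S
    · apply concl 4; intro w; rw [hcyl w]
      rcases inter23_cases w with ⟨h, ha, hb⟩ | ⟨h, ha, hb⟩ | ⟨h, ha, hb⟩ | ⟨h, ha, hb⟩ <;> rw [h] <;> simp [ha, hb, he, hp, hq, h01]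
    · apply concl 2; intro w; rw [hcyl w]
      rcases inter23_cases w with ⟨h, ha, hb⟩ | ⟨h, ha, hb⟩ | ⟨h, ha, hb⟩ | ⟨h, ha, hb⟩ <;> rw [h] <;> simp [ha, hb, he, hp, hq, h01]
  by_cases hq : ({3} : Finset (Fin 4)) ∈ S
  · have h01 : ({2, 3} : Finset (Fin 4)) ∈ S := up _ _ s1 hq
    apply concl 3; intro w; rw [hcyl w]
    rcases inter23_cases w with ⟨h, ha, hb⟩ | ⟨h, ha, hb⟩ | ⟨h, ha, hb⟩ | ⟨h, ha, hb⟩ <;> rw [h] <;> simp [ha, hb, he, hp, hq, h01]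
  by_cases h01 : ({2, 3} : Finset (Fin 4)) ∈ S
  · apply concl 1; intro w; rw [hcyl w]
    rcases inter23_cases w with ⟨h, ha, hb⟩ | ⟨h, ha, hb⟩ | ⟨h, ha, hb⟩ | ⟨h, ha, hb⟩ <;> rw [h] <;> simp [ha, hb, he, hp, hq, h01]
  · apply concl 0; intro w; rw [hcyl w]
    rcases inter23_cases w with ⟨h, ha, hb⟩ | ⟨h, ha, hb⟩ | ⟨h, ha, hb⟩ | ⟨h, ha, hb⟩ <;> rw [h] <;> simp [ha, hb, he, hp, hq, h01]

/-- **Dispatch**: every admissible pair of byte masks has a kernel-checked certificate (rows `check_row_*` of `…CertA–H`). [this work] -/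
theorem exists_check : ∀ n₀ ∈ L20, ∀ n₁ ∈ L20, sub8mask n₀ n₁ = true → ∃ D : ℕ, ∃ L : List Atom, 0 < D ∧ check n₀ n₁ D L = true := by
  intro n₀ h₀ n₁ h₁ hs
  simp only [L20, List.mem_cons, List.not_mem_nil, or_false] at h₀
  rcases h₀ with rfl | rfl | rfl | rfl | rfl | rfl | rfl | rfl | rfl | rfl | rfl | rfl | rfl | rfl | rfl | rfl | rfl | rfl | rfl | rfl
  · exact ⟨_, _, check_row_0 n₁ h₁ hs⟩
  · exact ⟨_, _, check_row_128 n₁ h₁ hs⟩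
  · exact ⟨_, _, check_row_136 n₁ h₁ hs⟩
  · exact ⟨_, _, check_row_160 n₁ h₁ hs⟩
  · exact ⟨_, _, check_row_168 n₁ h₁ hs⟩
  · exact ⟨_, _, check_row_170 n₁ h₁ hs⟩
  · exact ⟨_, _, check_row_192 n₁ h₁ hs⟩
  · exact ⟨_, _, check_row_200 n₁ h₁ hs⟩
  · exact ⟨_, _, check_row_204 n₁ h₁ hs⟩
  · exact ⟨_, _, check_row_224 n₁ h₁ hs⟩
  · exact ⟨_, _, check_row_232 n₁ h₁ hs⟩
  · exact ⟨_, _, check_row_234 n₁ h₁ hs⟩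
  · exact ⟨_, _, check_row_236 n₁ h₁ hs⟩
  · exact ⟨_, _, check_row_238 n₁ h₁ hs⟩
  · exact ⟨_, _, check_row_240 n₁ h₁ hs⟩
  · exact ⟨_, _, check_row_248 n₁ h₁ hs⟩
  · exact ⟨_, _, check_row_250 n₁ h₁ hs⟩
  · exact ⟨_, _, check_row_252 n₁ h₁ hs⟩
  · exact ⟨_, _, check_row_254 n₁ h₁ hs⟩
  · exact ⟨_, _, check_row_255 n₁ h₁ hs⟩

end Cell22

open Finset

/-- **THEOREM (`TRI_W ≥ 0` on every cell `(c,2,2)`; (M⁺⁺-3) on the triangle-class cells with two blocks of size `2`).**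
For every finite index cube `Finset ζ`, every up-set `P` of `W = Finset (Fin 4)`, and all MONOTONE families `F, G` indexed by `Finset ζ`
with values among the six `X`-cylinder up-sets `Cell22.cylX u` resp. the six `Y`-cylinder up-sets `Cell22.cylY v` of `W`:
`0 ≤ triW P F G`.  Proof: the masks of `P` (`Cell22.exists_masks`), the certificate of that pair of masks (`Cell22.exists_check`), and the
generic certificate theorem `Cell22.triW_nonneg_of_check`. [this work] -/
theorem triW_nonneg_cell22 {ζ : Type} [DecidableEq ζ] [Fintype ζ] (P : Finset (Finset (Fin 4)))
    (F G : Finset ζ → Finset (Finset (Fin 4))) (hP : IsUpperSet (P : Set (Finset (Fin 4)))) (hFm : Monotone F) (hGm : Monotone G)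
    (hF : ∀ z, ∃ u : Fin 6, F z = Cell22.cylX u) (hG : ∀ z, ∃ v : Fin 6, G z = Cell22.cylY v) : 0 ≤ triW P F G := by
  choose gc hgc using hF
  choose hc hhc using hG
  obtain ⟨n₀, h₀, n₁, h₁, hsub, hmask⟩ := Cell22.exists_masks P hP
  obtain ⟨D, L, hD, hchk⟩ := Cell22.exists_check n₀ h₀ n₁ h₁ hsub
  exact Cell22.triW_nonneg_of_check hchk hD P F G gc hc hmask hgc hhc hFm hGm

/-- **The same theorem with the cylinder hypotheses in their natural form**: `F z`, `G z` up-sets of `W = Finset (Fin 4)` whose membership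
depends only on the coordinates `{0,1}` resp. `{2,3}` (i.e. `F z = A_z × 2^{2,3}`, `G z = 2^{0,1} × B_z` for up-sets `A_z`, `B_z` of the two
squares), `F, G` monotone, `P` any up-set: `0 ≤ triW P F G` — `TRI ≥ 0` on the cells `(c,2,2)` for every `c`. [this work] -/
theorem triW_nonneg_cell22_of_cylinder {ζ : Type} [DecidableEq ζ] [Fintype ζ] (P : Finset (Finset (Fin 4)))
    (F G : Finset ζ → Finset (Finset (Fin 4))) (hP : IsUpperSet (P : Set (Finset (Fin 4))))
    (hF : ∀ z, IsUpperSet (F z : Set (Finset (Fin 4)))) (hG : ∀ z, IsUpperSet (G z : Set (Finset (Fin 4))))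
    (hFc : ∀ z w, w ∈ F z ↔ w ∩ {0, 1} ∈ F z) (hGc : ∀ z w, w ∈ G z ↔ w ∩ {2, 3} ∈ G z)
    (hFm : Monotone F) (hGm : Monotone G) : 0 ≤ triW P F G :=
  triW_nonneg_cell22 P F G hP hFm hGm (fun z => Cell22.exists_cylX_of_cylinder (F z) (hF z) (hFc z))
    (fun z => Cell22.exists_cylY_of_cylinder (G z) (hG z) (hGc z))

end FiveUpSet

end Summit.CriticalPhenomena.PercolationContinuityZ3.Theorems
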